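import Mathlib
import HarnessLib
import Summits.RiemannHypothesis.RiemannHypothesis.Theorems.EarlyAppointmentsRemainder0XiFarLogKernelBasics
import Summits.RiemannHypothesis.RiemannHypothesis.Theorems.EarlyAppointmentsRemainder0XiSubstitutionHelper

/-!
# Substitution Identity for Far Log-Kernel

Proves mainIntegral_subst_form: after substitution v = t/x, mainIntegral equals a v-space integral.
Uses Ioi_integral_subst and integrand_subst from the SubstitutionHelper file.

Supports stmt-RiemannHypothesis-24730 (Remainder0Xi crux).
-/

set_option linter.dupNamespace false
namespace Summit.RiemannHypothesis.RiemannHypothesis.Cruxes.Remainder0Xi.Rho2V2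

open scoped BigOperators Topology Classical
open Real Complex MeasureTheory Set Filter

open Summit.RiemannHypothesis.RiemannHypothesis.Theorems.EarlyAppointmentsRemainder0Xi.SubstitutionHelpers

/-- Key substitution identity: after v = t/x, mainIntegral equals the v-space integral.

The proof uses `intervalIntegral.smul_integral_comp_mul_left` for the finite interval,
`Ioi_integral_subst` for the Ioi integral, and `integrand_subst` to simplify the integrand. -/
lemma mainIntegral_subst_form {x : ℝ} (hx : T_PT / 2 < x) :
    mainIntegral x = (1 / Real.pi) *
      ((∫ v in Ioo (lowStart / x) (1 - boxHalfWidth / x), Real.log (x * v / (2 * Real.pi)) / (1 - v ^ 2)) +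
       ∫ v in Ioi (1 + boxHalfWidth / x), Real.log (x * v / (2 * Real.pi)) / (1 - v ^ 2)) := by
  have hx_pos := pos_of_T_PT_half_lt hx
  have hx_ne : x ≠ 0 := hx_pos.ne'
  have hx_large : 1000 < x := by linarith [T_PT_half_large]

  have hε_pos : 0 < lowStart / x := div_pos (by norm_num : (0 : ℝ) < 14) hx_pos
  have hδ_pos : 0 < boxHalfWidth / x := div_pos (by norm_num [boxHalfWidth] : (0 : ℝ) < boxHalfWidth) hx_pos
  have hε : lowStart / x < 1 - boxHalfWidth / x := by
    have h1 := lowStart_div_x_small hx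
    have h2 := boxHalfWidth_div_x_small hx
    linarith
  have h_lower_ab : lowStart < x - boxHalfWidth := by simp only [boxHalfWidth, lowStart]; linarith

  -- Step 1: Transform the Ioi integral using Ioi_integral_subst
  have h_Ioi := Ioi_integral_subst (R := 2 * boxHalfWidth) hx_pos
  have hR_simp : 2 * boxHalfWidth / 2 = boxHalfWidth := by ring
  have hRx_simp : 2 * boxHalfWidth / (2 * x) = boxHalfWidth / x := by field_simp
  rw [hR_simp, hRx_simp] at h_Ioi

  -- Integrand simplification for Ioi
  have h_Ioi_integrand : ∀ v : ℝ, v ∈ Ioi (1 + boxHalfWidth / x) →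
      x * (Real.log (x * v / (2 * Real.pi)) * (2 * x / (x ^ 2 - (x * v) ^ 2))) =
      Real.log (x * v / (2 * Real.pi)) * (2 / (1 - v ^ 2)) := by
    intro v hv
    have hv_gt_1 : 1 < v := by linarith [mem_Ioi.mp hv, hδ_pos]
    have hv_sq_ne : 1 - v ^ 2 ≠ 0 := by nlinarith [sq_nonneg v, sq_nonneg (v - 1)]
    exact integrand_subst hx_ne hv_sq_ne

  -- Integrand simplification for lower interval
  have h_lower_integrand : ∀ v : ℝ, v ∈ Ioo (lowStart / x) (1 - boxHalfWidth / x) →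
      x * (Real.log (x * v / (2 * Real.pi)) * (2 * x / (x ^ 2 - (x * v) ^ 2))) =
      Real.log (x * v / (2 * Real.pi)) * (2 / (1 - v ^ 2)) := by
    intro v hv
    have hv_pos : 0 < v := lt_trans hε_pos hv.1
    have hv_lt_1 : v < 1 := by linarith [hv.2, hδ_pos]
    have hv_sq_lt_1 : v ^ 2 < 1 := by
      have hv_abs : |v| < 1 := abs_lt.mpr ⟨by linarith, hv_lt_1⟩
      calc v ^ 2 = |v| ^ 2 := (sq_abs v).symm
        _ < 1 ^ 2 := sq_lt_sq' (by linarith [abs_nonneg v]) hv_abs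
        _ = 1 := one_pow 2
    have hv_sq_ne : 1 - v ^ 2 ≠ 0 := by linarith
    exact integrand_subst hx_ne hv_sq_ne

  have h2pi_ne : (2 : ℝ) * Real.pi ≠ 0 := by positivity
  have hpi_ne : Real.pi ≠ 0 := Real.pi_ne_zero

  -- Transform upper integral
  have h_upper_transform : ∫ t in Ioi (x + boxHalfWidth),
      Real.log (t / (2 * Real.pi)) * (2 * x / (x ^ 2 - t ^ 2)) =
      2 * ∫ v in Ioi (1 + boxHalfWidth / x), Real.log (x * v / (2 * Real.pi)) / (1 - v ^ 2) := by
    rw [h_Ioi]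
    have heq : ∀ v : ℝ, v ∈ Ioi (1 + boxHalfWidth / x) →
        x * (Real.log (x * v / (2 * Real.pi)) * (2 * x / (x ^ 2 - (x * v) ^ 2))) =
        2 * (Real.log (x * v / (2 * Real.pi)) / (1 - v ^ 2)) := by
      intro v hv; rw [h_Ioi_integrand v hv]; ring
    calc x * ∫ v in Ioi (1 + boxHalfWidth / x),
          Real.log (x * v / (2 * Real.pi)) * (2 * x / (x ^ 2 - (x * v) ^ 2))
        = ∫ v in Ioi (1 + boxHalfWidth / x),
            x * (Real.log (x * v / (2 * Real.pi)) * (2 * x / (x ^ 2 - (x * v) ^ 2))) := by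
          rw [← MeasureTheory.integral_const_mul]
      _ = ∫ v in Ioi (1 + boxHalfWidth / x),
            2 * (Real.log (x * v / (2 * Real.pi)) / (1 - v ^ 2)) := by
          apply MeasureTheory.setIntegral_congr_fun measurableSet_Ioi heq
      _ = 2 * ∫ v in Ioi (1 + boxHalfWidth / x),
            Real.log (x * v / (2 * Real.pi)) / (1 - v ^ 2) := by
          rw [MeasureTheory.integral_const_mul]

  -- Transform lower integral via smul_integral_comp_mul_left
  have h_lower_bounds : x * (lowStart / x) = lowStart ∧ x * (1 - boxHalfWidth / x) = x - boxHalfWidth := by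
    constructor <;> field_simp

  have h_lower_subst_eq : ∫ t in lowStart..(x - boxHalfWidth),
      Real.log (t / (2 * Real.pi)) * (2 * x / (x ^ 2 - t ^ 2)) =
      x * ∫ v in (lowStart / x)..(1 - boxHalfWidth / x),
        Real.log (x * v / (2 * Real.pi)) * (2 * x / (x ^ 2 - (x * v) ^ 2)) := by
    have hsub := intervalIntegral.smul_integral_comp_mul_left
      (fun v => Real.log (v / (2 * Real.pi)) * (2 * x / (x ^ 2 - v ^ 2)))
      x (a := lowStart / x) (b := 1 - boxHalfWidth / x)
    simp only [smul_eq_mul, h_lower_bounds.1, h_lower_bounds.2] at hsub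
    rw [← hsub]

  have hab : lowStart / x ≤ 1 - boxHalfWidth / x := le_of_lt hε
  have h_interval_to_Ioc : ∫ v in (lowStart / x)..(1 - boxHalfWidth / x),
      Real.log (x * v / (2 * Real.pi)) * (2 * x / (x ^ 2 - (x * v) ^ 2)) =
      ∫ v in Ioc (lowStart / x) (1 - boxHalfWidth / x),
        Real.log (x * v / (2 * Real.pi)) * (2 * x / (x ^ 2 - (x * v) ^ 2)) := by
    rw [intervalIntegral.integral_of_le hab]

  have h_Ioc_to_Ioo : ∫ v in Ioc (lowStart / x) (1 - boxHalfWidth / x),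
      Real.log (x * v / (2 * Real.pi)) * (2 * x / (x ^ 2 - (x * v) ^ 2)) =
      ∫ v in Ioo (lowStart / x) (1 - boxHalfWidth / x),
        Real.log (x * v / (2 * Real.pi)) * (2 * x / (x ^ 2 - (x * v) ^ 2)) := by
    apply MeasureTheory.setIntegral_congr_set Ioo_ae_eq_Ioc.symm

  have h_lower_transform : ∫ t in lowStart..(x - boxHalfWidth),
      Real.log (t / (2 * Real.pi)) * (2 * x / (x ^ 2 - t ^ 2)) =
      2 * ∫ v in Ioo (lowStart / x) (1 - boxHalfWidth / x),
        Real.log (x * v / (2 * Real.pi)) / (1 - v ^ 2) := by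
    rw [h_lower_subst_eq, h_interval_to_Ioc, h_Ioc_to_Ioo]
    have heq : ∀ v : ℝ, v ∈ Ioo (lowStart / x) (1 - boxHalfWidth / x) →
        x * (Real.log (x * v / (2 * Real.pi)) * (2 * x / (x ^ 2 - (x * v) ^ 2))) =
        2 * (Real.log (x * v / (2 * Real.pi)) / (1 - v ^ 2)) := by
      intro v hv; rw [h_lower_integrand v hv]; ring
    calc x * ∫ v in Ioo (lowStart / x) (1 - boxHalfWidth / x),
          Real.log (x * v / (2 * Real.pi)) * (2 * x / (x ^ 2 - (x * v) ^ 2))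
        = ∫ v in Ioo (lowStart / x) (1 - boxHalfWidth / x),
            x * (Real.log (x * v / (2 * Real.pi)) * (2 * x / (x ^ 2 - (x * v) ^ 2))) := by
          rw [← MeasureTheory.integral_const_mul]
      _ = ∫ v in Ioo (lowStart / x) (1 - boxHalfWidth / x),
            2 * (Real.log (x * v / (2 * Real.pi)) / (1 - v ^ 2)) := by
          apply MeasureTheory.setIntegral_congr_fun measurableSet_Ioo heq
      _ = 2 * ∫ v in Ioo (lowStart / x) (1 - boxHalfWidth / x),
            Real.log (x * v / (2 * Real.pi)) / (1 - v ^ 2) := by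
          rw [MeasureTheory.integral_const_mul]

  -- Combine using (1/2π) * 2 = 1/π
  unfold mainIntegral
  set I_lower := ∫ v in Ioo (lowStart / x) (1 - boxHalfWidth / x),
      Real.log (x * v / (2 * Real.pi)) / (1 - v ^ 2) with hI_lower
  set I_upper := ∫ v in Ioi (1 + boxHalfWidth / x),
      Real.log (x * v / (2 * Real.pi)) / (1 - v ^ 2) with hI_upper

  calc 1 / (2 * Real.pi) *
      ((∫ t in lowStart..(x - boxHalfWidth),
          Real.log (t / (2 * Real.pi)) * (2 * x / (x ^ 2 - t ^ 2))) +
       ∫ t in Ioi (x + boxHalfWidth),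
          Real.log (t / (2 * Real.pi)) * (2 * x / (x ^ 2 - t ^ 2)))
      = 1 / (2 * Real.pi) * (2 * I_lower + 2 * I_upper) := by rw [h_lower_transform, h_upper_transform]
    _ = 1 / (2 * Real.pi) * (2 * (I_lower + I_upper)) := by ring_nf
    _ = (1 / (2 * Real.pi) * 2) * (I_lower + I_upper) := by ring
    _ = 1 / Real.pi * (I_lower + I_upper) := by
          have h2pi : (2 : ℝ) * Real.pi ≠ 0 := by positivity
          have hpi : Real.pi ≠ 0 := Real.pi_ne_zero
          field_simp

end Summit.RiemannHypothesis.RiemannHypothesis.Cruxes.Remainder0Xi.Rho2V2
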